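import Mathlib.Analysis.SpecialFunctions.Exp
import Mathlib.Algebra.Order.BigOperators.Group.Finset
import Mathlib.Topology.Algebra.Order.LiminfLimsup
import HarnessLib

/-!
# THE SENSITIVITY ALGEBRA OF A BACKGROUND-FORM REPRESENTATION (LINE g24-4 «background_form», toolkit lifted into `Theorems/`)

Cell `ym3-torus` (YM ladder rung R3 = continuum `SU(2)` Yang–Mills on the three-torus — a RUNG, NOT d = 4, NOT infinite volume, NOT a mass gap, NOT Clay).  Width seat
`ym-ust-20520-w3` (gen 20, LEAD-20520 by lineage); `--supports stmt-QuantumFields-20520 --as helper`, count-neutral, definition-free, default heartbeats, abstract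
(no Bałaban object appears in this file).

WHAT THIS IS.  Ideator `ym-r3-idea-1` g24 published LINE №14 = g24-4 «background_form» (`Cruxes/FluctuationComparisonRegPrIntL/Lines/background_form.lean`
sha16 5f0065306aa4d283, card `Lines/background_form.md`): the PATH-B organ S2β `FluctuationPartSmall` of crux `stmt-QuantumFields-20520`
(`UnitScaleTilt.FluctuationComparisonRegPrIntL`) and the first-order row GRAD∘ follow from ONE print-shaped row BGFORM∘ — «on the window,
`log ρ U + β_K𝔄^reg U = c₀ + Σ_X T X (M U)` with `M` a background map ([Balaban1985Variational] Prop. 9 p.309, (182)–(190) pp.307–308), terms `T X` Lipschitz and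
discrete-C^{1,1} in the background variables on `X` ([Balaban1987RG1] (0.22)–(0.25) pp.256–257; [Balaban1989LargeFieldII] (1.98)–(1.100) p.390), summable moduli,
exponentially localized response» — by an ABSTRACT sensitivity algebra (the line's §2 = its toolkit `Lines/background_form_algebra.lean` 16a43cd95c52e6a8).  Crux
workfiles are not importable; this file is that §2, LIFTED VERBATIM (names and statements unchanged, proofs g24's) so that `Theorems/` can use it; the junctions
BGFORM∘ → S2β and BGFORM∘ → GRAD∘ are lifted in the sibling file `…BackgroundFormKnit`.  All credit for the mathematics below: ideator g24.

CONTENTS (all abstract; finite index types, a normed group of «background variables», real moduli):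
* §1 `oneBond_le_of_sensitivity` (first order: one-bond oscillation of `f = c₀ + Σ_X T X ∘ M` from Lipschitz moduli and one-bond sensitivities of `M`),
  `fourPoint_le_of_sensitivity` (second order: the connected four-point difference over a square of moves from C^{1,1} moduli and first∕mixed sensitivities),
  `fourPoint_rearrange`.
* §2 `sum_mul_sum_supp_le` (one-pin exchange), `sum_mul_sum_mul_sum_supp_le` (two-pin exchange), `exp_convolution_le` (three-factor exponential convolution through
  the triangle inequality: `Σ_{e,e′} e^{−2μd(b,e)} e^{−2μd(e,e′)} e^{−2μd(e′,b′)} ≤ C²·e^{−μd(b,b′)}`), `exp_convolution_two_le`, `exp_two_mul_le`.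
* §3 `tendsto_zero_of_superpoly`, `tendsto_mul_of_superpoly`, `tendsto_phi_of_superpoly` (`J·(H C² σ_J² + A C σ₂,J) → 0`), `superpoly_const_mul`.

HONEST: elementary real analysis ∕ finite sums; nothing of Bałaban's is asserted or proved; BGFORM∘ is a HYPOTHESIS of the line (its one stub, XL); S2β, GRAD∘,
`FluctuationComparisonRegPrIntL` (20520) and `YM3TorusSU2` are NOT proved by this file; the registered skeleton v11.4 and its five stubs are untouched (0∕5).
[cite: Balaban1985Variational, Prop. 9 p.309, (182)-(190) pp.307-308; Balaban1987RG1, (0.22)-(0.25) pp.256-257, Thm 1 p.259; Balaban1989LargeFieldII, (1.98)-(1.100) p.390; Balaban1985UV3, Thm 2 p.263]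
-/

set_option autoImplicit false

noncomputable section

namespace Summit.QuantumFields.YangMills.Theorems.FluctuationComparisonRegPrIntLBackgroundFormAlgebra

open Filter Topology
open scoped BigOperators

/-! ## §1 First and second order sensitivity of `f = c₀ + Σ_X T X ∘ M` (g24 toolkit §1) -/

section AlgebraA

variable {ι E G H 𝓧 : Type*} [Fintype 𝓧] [NormedAddCommGroup H]

/-- **First order.** One-bond oscillation of `f = c₀ + Σ_X T X ∘ M` from Lipschitz moduli of the terms in their support variables and one-bond
sensitivities of the background map. -/
theorem oneBond_le_of_sensitivity
    (supp : 𝓧 → Finset E) (T : 𝓧 → (E → H) → ℝ) (ℓ : 𝓧 → ℝ) (M : (ι → G) → (E → H))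
    (S : Set (ι → G)) (S' : Set (E → H)) (c₀ : ℝ) (f : (ι → G) → ℝ) (s : ι → E → ℝ)
    (hℓ : ∀ X, 0 ≤ ℓ X)
    (hMS : ∀ V, V ∈ S → M V ∈ S')
    (hlip : ∀ X u u', u ∈ S' → u' ∈ S' → |T X u - T X u'| ≤ ℓ X * ∑ e ∈ supp X, ‖u e - u' e‖)
    (hrep : ∀ V, V ∈ S → f V = c₀ + ∑ X, T X (M V))
    (b : ι) (V V' : ι → G) (hV : V ∈ S) (hV' : V' ∈ S)
    (hsens : ∀ e, ‖M V e - M V' e‖ ≤ s b e) :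
    |f V - f V'| ≤ ∑ X, ℓ X * ∑ e ∈ supp X, s b e := by
  have hdiff : f V - f V' = ∑ X, (T X (M V) - T X (M V')) := by
    rw [hrep V hV, hrep V' hV', Finset.sum_sub_distrib]; ring
  rw [hdiff]
  refine (Finset.abs_sum_le_sum_abs _ _).trans (Finset.sum_le_sum fun X _ => ?_)
  refine (hlip X _ _ (hMS V hV) (hMS V' hV')).trans ?_
  exact mul_le_mul_of_nonneg_left (Finset.sum_le_sum fun e _ => hsens e) (hℓ X)

/-- **Second order.** The connected four-point difference of `f = c₀ + Σ_X T X ∘ M` over a square of window data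
(`V₁₀` = `V₀₀` moved at `b`, `V₀₁` = `V₀₀` moved at `b'`, `V₁₁` = both) from discrete-C^{1,1} moduli of the terms and first- and mixed second-order
sensitivities of the background map. -/
theorem fourPoint_le_of_sensitivity
    (supp : 𝓧 → Finset E) (T : 𝓧 → (E → H) → ℝ) (ℓ h : 𝓧 → ℝ) (M : (ι → G) → (E → H))
    (S : Set (ι → G)) (S' : Set (E → H)) (c₀ : ℝ) (f : (ι → G) → ℝ) (s : ι → E → ℝ) (s₂ : ι → ι → E → ℝ)
    (hℓ : ∀ X, 0 ≤ ℓ X) (hh : ∀ X, 0 ≤ h X) (hs : ∀ b e, 0 ≤ s b e)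
    (hMS : ∀ V, V ∈ S → M V ∈ S')
    (hC11 : ∀ X u₀₀ u₁₀ u₀₁ u₁₁, u₀₀ ∈ S' → u₁₀ ∈ S' → u₀₁ ∈ S' → u₁₁ ∈ S' →
      |T X u₁₁ - T X u₁₀ - T X u₀₁ + T X u₀₀| ≤
        h X * (∑ e ∈ supp X, ‖u₁₀ e - u₀₀ e‖) * (∑ e ∈ supp X, ‖u₀₁ e - u₀₀ e‖) +
          ℓ X * ∑ e ∈ supp X, ‖u₁₁ e - u₁₀ e - u₀₁ e + u₀₀ e‖)
    (hrep : ∀ V, V ∈ S → f V = c₀ + ∑ X, T X (M V))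
    (b b' : ι) (V₀₀ V₁₀ V₀₁ V₁₁ : ι → G) (h₀₀ : V₀₀ ∈ S) (h₁₀ : V₁₀ ∈ S) (h₀₁ : V₀₁ ∈ S) (h₁₁ : V₁₁ ∈ S)
    (hsens₁ : ∀ e, ‖M V₁₀ e - M V₀₀ e‖ ≤ s b e) (hsens₂ : ∀ e, ‖M V₀₁ e - M V₀₀ e‖ ≤ s b' e)
    (hsens₁₂ : ∀ e, ‖M V₁₁ e - M V₁₀ e - M V₀₁ e + M V₀₀ e‖ ≤ s₂ b b' e) :
    |f V₁₁ - f V₁₀ - f V₀₁ + f V₀₀| ≤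
      ∑ X, (h X * (∑ e ∈ supp X, s b e) * (∑ e ∈ supp X, s b' e) + ℓ X * ∑ e ∈ supp X, s₂ b b' e) := by
  have hdiff : f V₁₁ - f V₁₀ - f V₀₁ + f V₀₀ =
      ∑ X, (T X (M V₁₁) - T X (M V₁₀) - T X (M V₀₁) + T X (M V₀₀)) := by
    rw [hrep _ h₁₁, hrep _ h₁₀, hrep _ h₀₁, hrep _ h₀₀]
    simp only [Finset.sum_add_distrib, Finset.sum_sub_distrib]; ring
  rw [hdiff]
  refine (Finset.abs_sum_le_sum_abs _ _).trans (Finset.sum_le_sum fun X _ => ?_)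
  refine (hC11 X _ _ _ _ (hMS _ h₀₀) (hMS _ h₁₀) (hMS _ h₀₁) (hMS _ h₁₁)).trans ?_
  have hA : ∑ e ∈ supp X, ‖M V₁₀ e - M V₀₀ e‖ ≤ ∑ e ∈ supp X, s b e := Finset.sum_le_sum fun e _ => hsens₁ e
  have hB : ∑ e ∈ supp X, ‖M V₀₁ e - M V₀₀ e‖ ≤ ∑ e ∈ supp X, s b' e := Finset.sum_le_sum fun e _ => hsens₂ e
  have hC : ∑ e ∈ supp X, ‖M V₁₁ e - M V₁₀ e - M V₀₁ e + M V₀₀ e‖ ≤ ∑ e ∈ supp X, s₂ b b' e :=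
    Finset.sum_le_sum fun e _ => hsens₁₂ e
  have hB0 : 0 ≤ ∑ e ∈ supp X, ‖M V₀₁ e - M V₀₀ e‖ := Finset.sum_nonneg fun e _ => norm_nonneg _
  have hsB : 0 ≤ ∑ e ∈ supp X, s b e := Finset.sum_nonneg fun e _ => hs b e
  exact add_le_add (mul_le_mul (mul_le_mul_of_nonneg_left hA (hh X)) hB hB0 (mul_nonneg (hh X) hsB))
    (mul_le_mul_of_nonneg_left hC (hℓ X))

/-- The S2β-shaped corollary: with `U := V₁₁, V := V₀₁, W := V₁₀, Z := V₀₀` the square's connected difference is `(f U − f V) − (f W − f Z)`. -/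
theorem fourPoint_rearrange (f : (ι → G) → ℝ) (V₀₀ V₁₀ V₀₁ V₁₁ : ι → G) :
    (f V₁₁ - f V₀₁) - (f V₁₀ - f V₀₀) = f V₁₁ - f V₁₀ - f V₀₁ + f V₀₀ := by ring

end AlgebraA

/-! ## §2 Pin exchanges and exponential convolutions (g24 toolkit §2) -/

section AlgebraB

variable {E 𝓧 : Type*} [Fintype E] [Fintype 𝓧]

/-- **One-pin exchange.** `Σ_X ℓ X · Σ_{e ∈ supp X} s e = Σ_e s e · Σ_{X : e ∈ supp X} ℓ X`; hence pinned sums `≤ A` and `Σ_e s e ≤ B` bound the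
first-order right-hand side of `oneBond_le_of_sensitivity` by `A · B`. -/
theorem sum_mul_sum_supp_le [DecidableEq E] (supp : 𝓧 → Finset E) (ℓ : 𝓧 → ℝ) (s : E → ℝ) (A B : ℝ)
    (hs : ∀ e, 0 ≤ s e)
    (hpin : ∀ e, ∑ X ∈ Finset.univ.filter (fun X => e ∈ supp X), ℓ X ≤ A)
    (hB : ∑ e, s e ≤ B) (hA : 0 ≤ A) :
    ∑ X, ℓ X * ∑ e ∈ supp X, s e ≤ A * B := by
  classical
  have hex : ∑ X, ℓ X * ∑ e ∈ supp X, s e = ∑ e, s e * ∑ X ∈ Finset.univ.filter (fun X => e ∈ supp X), ℓ X := by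
    simp_rw [Finset.mul_sum]
    rw [Finset.sum_comm' (s' := fun e => Finset.univ.filter (fun X => e ∈ supp X)) (t' := Finset.univ)]
    · exact Finset.sum_congr rfl fun e _ => Finset.sum_congr rfl fun X _ => mul_comm _ _
    · intro X e; simp
  rw [hex]
  calc ∑ e, s e * ∑ X ∈ Finset.univ.filter (fun X => e ∈ supp X), ℓ X
      ≤ ∑ e, s e * A := Finset.sum_le_sum fun e _ => mul_le_mul_of_nonneg_left (hpin e) (hs e)
    _ = (∑ e, s e) * A := (Finset.sum_mul _ _ _).symm
    _ ≤ B * A := mul_le_mul_of_nonneg_right hB hA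
    _ = A * B := mul_comm _ _

/-- **Two-pin exchange.** `Σ_X h X · (Σ_{e ∈ supp X} s e)(Σ_{e' ∈ supp X} t e') = Σ_{e,e'} s e · t e' · Σ_{X : e, e' ∈ supp X} h X`, so two-pinned bounds
`Σ_{X ∋ e,e'} h X ≤ K e e'` give `≤ Σ_{e,e'} s e · t e' · K e e'` (nonnegative weights). -/
theorem sum_mul_sum_mul_sum_supp_le [DecidableEq E] (supp : 𝓧 → Finset E) (h : 𝓧 → ℝ) (s t : E → ℝ) (K : E → E → ℝ)
    (hs : ∀ e, 0 ≤ s e) (ht : ∀ e, 0 ≤ t e)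
    (hpin : ∀ e e', ∑ X ∈ Finset.univ.filter (fun X => e ∈ supp X ∧ e' ∈ supp X), h X ≤ K e e') :
    ∑ X, h X * (∑ e ∈ supp X, s e) * (∑ e' ∈ supp X, t e') ≤ ∑ e, ∑ e', s e * t e' * K e e' := by
  classical
  have h1 : ∀ X, h X * (∑ e ∈ supp X, s e) * (∑ e' ∈ supp X, t e') = ∑ e ∈ supp X, ∑ e' ∈ supp X, s e * t e' * h X := by
    intro X
    rw [Finset.mul_sum (supp X) s (h X), Finset.sum_mul (supp X) (fun e => h X * s e)]
    refine Finset.sum_congr rfl fun e _ => ?_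
    rw [Finset.mul_sum]
    exact Finset.sum_congr rfl fun e' _ => by ring
  have hex : ∑ X, h X * (∑ e ∈ supp X, s e) * (∑ e' ∈ supp X, t e') =
      ∑ e, ∑ e', s e * t e' * ∑ X ∈ Finset.univ.filter (fun X => e ∈ supp X ∧ e' ∈ supp X), h X := by
    simp_rw [h1]
    rw [Finset.sum_comm' (s' := fun e => Finset.univ.filter (fun X => e ∈ supp X)) (t' := Finset.univ)]
    swap
    · intro X e; simp
    refine Finset.sum_congr rfl fun e _ => ?_
    rw [Finset.sum_comm' (s' := fun e' => Finset.univ.filter (fun X => e ∈ supp X ∧ e' ∈ supp X)) (t' := Finset.univ)]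
    swap
    · intro X e'; simp
    refine Finset.sum_congr rfl fun e' _ => ?_
    rw [Finset.mul_sum]
  rw [hex]
  refine Finset.sum_le_sum fun e _ => Finset.sum_le_sum fun e' _ => ?_
  exact mul_le_mul_of_nonneg_left (hpin e e') (mul_nonneg (hs e) (ht e'))

/-- **Exponential convolution through the triangle inequality.** On a finite index with a pseudo-distance `d` (nonnegative, triangle inequality) and
a uniform summability constant `C` for the kernel `e^{−μ d(x,·)}`: `Σ_{e,e'} e^{−2μ d(b,e)} e^{−2μ d(e,e')} e^{−2μ d(e',b')} ≤ C² · e^{−μ d(b,b')}`. -/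
theorem exp_convolution_le (d : E → E → ℝ) (μ C : ℝ) (hμ : 0 ≤ μ) (hd : ∀ x y, 0 ≤ d x y)
    (htri : ∀ x y z, d x z ≤ d x y + d y z)
    (hsum : ∀ x, ∑ y, Real.exp (-(μ * d x y)) ≤ C) (b b' : E) :
    ∑ e, ∑ e', Real.exp (-(2 * μ * d b e)) * Real.exp (-(2 * μ * d e e')) * Real.exp (-(2 * μ * d e' b')) ≤
      C ^ 2 * Real.exp (-(μ * d b b')) := by
  have hC : 0 ≤ C := le_trans (Finset.sum_nonneg fun y _ => (Real.exp_pos _).le) (hsum b)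
  have hpt : ∀ e e', Real.exp (-(2 * μ * d b e)) * Real.exp (-(2 * μ * d e e')) * Real.exp (-(2 * μ * d e' b')) ≤
      Real.exp (-(μ * d b b')) * (Real.exp (-(μ * d b e)) * Real.exp (-(μ * d e e'))) := by
    intro e e'
    have htri' : d b b' ≤ d b e + d e e' + d e' b' := by
      have h₁ := htri b e b'; have h₂ := htri e e' b'; linarith
    rw [← Real.exp_add, ← Real.exp_add, ← Real.exp_add, ← Real.exp_add, Real.exp_le_exp]
    have h1 := mul_le_mul_of_nonneg_left htri' hμ
    have h2 := mul_nonneg hμ (hd e' b')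
    have h3 := mul_nonneg hμ (hd b e)
    have h4 := mul_nonneg hμ (hd e e')
    nlinarith
  calc ∑ e, ∑ e', Real.exp (-(2 * μ * d b e)) * Real.exp (-(2 * μ * d e e')) * Real.exp (-(2 * μ * d e' b'))
      ≤ ∑ e, ∑ e', Real.exp (-(μ * d b b')) * (Real.exp (-(μ * d b e)) * Real.exp (-(μ * d e e'))) :=
        Finset.sum_le_sum fun e _ => Finset.sum_le_sum fun e' _ => hpt e e'
    _ = Real.exp (-(μ * d b b')) * ∑ e, Real.exp (-(μ * d b e)) * ∑ e', Real.exp (-(μ * d e e')) := by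
        rw [Finset.mul_sum]; refine Finset.sum_congr rfl fun e _ => ?_; rw [Finset.mul_sum, Finset.mul_sum]
    _ ≤ Real.exp (-(μ * d b b')) * ∑ e, Real.exp (-(μ * d b e)) * C := by
        refine mul_le_mul_of_nonneg_left (Finset.sum_le_sum fun e _ => ?_) (Real.exp_pos _).le
        exact mul_le_mul_of_nonneg_left (hsum e) (Real.exp_pos _).le
    _ = Real.exp (-(μ * d b b')) * ((∑ e, Real.exp (-(μ * d b e))) * C) := by rw [Finset.sum_mul]
    _ ≤ Real.exp (-(μ * d b b')) * (C * C) :=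
        mul_le_mul_of_nonneg_left (mul_le_mul_of_nonneg_right (hsum b) hC) (Real.exp_pos _).le
    _ = C ^ 2 * Real.exp (-(μ * d b b')) := by ring

/-- Two-factor exponential convolution: `Σ_e e^{−2μ d(x,e)} e^{−2μ d(e,y)} ≤ C · e^{−μ d(x,y)}`. -/
theorem exp_convolution_two_le (d : E → E → ℝ) (μ C : ℝ) (hμ : 0 ≤ μ) (hd : ∀ x y, 0 ≤ d x y)
    (htri : ∀ x y z, d x z ≤ d x y + d y z)
    (hsum : ∀ x, ∑ y, Real.exp (-(μ * d x y)) ≤ C) (x y : E) :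
    ∑ e, Real.exp (-(2 * μ * d x e)) * Real.exp (-(2 * μ * d e y)) ≤ C * Real.exp (-(μ * d x y)) := by
  have hpt : ∀ e, Real.exp (-(2 * μ * d x e)) * Real.exp (-(2 * μ * d e y)) ≤
      Real.exp (-(μ * d x e)) * Real.exp (-(μ * d x y)) := by
    intro e
    rw [← Real.exp_add, ← Real.exp_add, Real.exp_le_exp]
    have h1 := mul_le_mul_of_nonneg_left (htri x e y) hμ
    have h2 := mul_nonneg hμ (hd x e)
    have h3 := mul_nonneg hμ (hd e y)
    nlinarith
  calc ∑ e, Real.exp (-(2 * μ * d x e)) * Real.exp (-(2 * μ * d e y))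
      ≤ ∑ e, Real.exp (-(μ * d x e)) * Real.exp (-(μ * d x y)) := Finset.sum_le_sum fun e _ => hpt e
    _ = (∑ e, Real.exp (-(μ * d x e))) * Real.exp (-(μ * d x y)) := (Finset.sum_mul _ _ _).symm
    _ ≤ C * Real.exp (-(μ * d x y)) := mul_le_mul_of_nonneg_right (hsum x) (Real.exp_pos _).le

/-- Halving the rate only increases the kernel. -/
theorem exp_two_mul_le (μ t : ℝ) (hμ : 0 ≤ μ) (ht : 0 ≤ t) : Real.exp (-(2 * μ * t)) ≤ Real.exp (-(μ * t)) := by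
  rw [Real.exp_le_exp]; nlinarith [mul_nonneg hμ ht]

end AlgebraB

/-! ## §3 Super-polynomial bookkeeping (g24) -/

section Superpoly

/-- A nonnegative super-polynomially small sequence tends to `0`. -/
theorem tendsto_zero_of_superpoly {σ : ℕ → ℝ}
    (hσ : ∀ a : ℕ, Tendsto (fun J : ℕ => ((J : ℝ) + 1) ^ a * σ J) atTop (𝓝 0)) :
    Tendsto σ atTop (𝓝 0) := by
  simpa using hσ 0

/-- … and so does `J · σ_J`. -/
theorem tendsto_mul_of_superpoly {σ : ℕ → ℝ} (hσ0 : ∀ J, 0 ≤ σ J)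
    (hσ : ∀ a : ℕ, Tendsto (fun J : ℕ => ((J : ℝ) + 1) ^ a * σ J) atTop (𝓝 0)) :
    Tendsto (fun J : ℕ => (J : ℝ) * σ J) atTop (𝓝 0) := by
  have h1 : Tendsto (fun J : ℕ => ((J : ℝ) + 1) ^ 1 * σ J) atTop (𝓝 0) := hσ 1
  refine tendsto_of_tendsto_of_tendsto_of_le_of_le tendsto_const_nhds h1 (fun J => ?_) (fun J => ?_)
  · exact mul_nonneg (Nat.cast_nonneg J) (hσ0 J)
  · have := hσ0 J
    have hJ : (0 : ℝ) ≤ J := Nat.cast_nonneg J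
    simp only [pow_one]
    nlinarith

/-- The S2β modulus manufactured from the response moduli: `J · (H C² σ_J² + A C σ₂,J) → 0`. -/
theorem tendsto_phi_of_superpoly {σ σ₂ : ℕ → ℝ} (Hc C A : ℝ) (hσ0 : ∀ J, 0 ≤ σ J) (hσ₂0 : ∀ J, 0 ≤ σ₂ J)
    (hσ : ∀ a : ℕ, Tendsto (fun J : ℕ => ((J : ℝ) + 1) ^ a * σ J) atTop (𝓝 0))
    (hσ₂ : ∀ a : ℕ, Tendsto (fun J : ℕ => ((J : ℝ) + 1) ^ a * σ₂ J) atTop (𝓝 0)) :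
    Tendsto (fun J : ℕ => (J : ℝ) * (Hc * C ^ 2 * σ J ^ 2 + A * C * σ₂ J)) atTop (𝓝 0) := by
  have h1 : Tendsto (fun J : ℕ => Hc * C ^ 2 * (((J : ℝ) * σ J) * σ J)) atTop (𝓝 0) := by
    have := ((tendsto_mul_of_superpoly hσ0 hσ).mul (tendsto_zero_of_superpoly hσ)).const_mul (Hc * C ^ 2)
    simpa using this
  have h2 : Tendsto (fun J : ℕ => A * C * ((J : ℝ) * σ₂ J)) atTop (𝓝 0) := by
    have := (tendsto_mul_of_superpoly hσ₂0 hσ₂).const_mul (A * C)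
    simpa using this
  have h := h1.add h2
  simp only [add_zero] at h
  exact Tendsto.congr (fun J => by ring) h

/-- The GRAD∘ modulus `A · C · σ_J` is super-polynomially small. -/
theorem superpoly_const_mul {σ : ℕ → ℝ} (c : ℝ)
    (hσ : ∀ a : ℕ, Tendsto (fun J : ℕ => ((J : ℝ) + 1) ^ a * σ J) atTop (𝓝 0)) :
    ∀ a : ℕ, Tendsto (fun J : ℕ => ((J : ℝ) + 1) ^ a * (c * σ J)) atTop (𝓝 0) := by
  intro a
  have := (hσ a).const_mul c
  simp only [mul_zero] at this
  exact Tendsto.congr (fun J => by ring) this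

end Superpoly

end Summit.QuantumFields.YangMills.Theorems.FluctuationComparisonRegPrIntLBackgroundFormAlgebra

end
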